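import Summits.RiemannHypothesis.RiemannHypothesis.Theorems.WeilFormatCCinfCertStagesEven
import Summits.RiemannHypothesis.RiemannHypothesis.Theorems.WeilFormatCCinfCertStageT
import Summits.RiemannHypothesis.RiemannHypothesis.Theorems.WeilFormatCCinfCertGlue
import HarnessLib

/-!
# Format C, design C∞ (E2 data side): even-sector GLUE — the door's middle-Gram and Hankel blocks as generic stage tables

Route context: Fourier–Galerkin / Schur-complement certificates of Weil positivity on a window ("format C", C∞ door;
pipeline spec `run/shared/lean/pub/rh-explicit/rh-explicit-weil-2/gen16/E2F-CERT-PIPELINE.md` §2; supporting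
stmt-RiemannHypothesis-0098; seat rh-explicit-weil-2).

The generic stages (`CinfStageT.TgenR`, `CinfStageL.LgenR`) work with `ℕ`-indexed real tables; the door's blocks
(`CinfStageE.TxxR …`, `CinfStageE.HxxR …`) are sums over `m ∈ Ico B m₀`, over `Fin r`, and over the family index
`Fin 4 × Fin D`.  This file names the glued / flattened `ℕ`-indexed tables of the even sector and proves the identities
that let the assembly stage read the claimed `T` and Hankel tables as the door's blocks:

* `CinfGlueE.gN` (resolved middle columns, x-rows then β-rows, column `t ↔ m = B + t`), `vN` (`1/wmid (B+t)`),
  `AN` (family-matrix rows on the flattened family index `f = y.2 + D·y.1`, `CinfGlue.flat`), `GeN`, `ceN`, `GAN` (`Σ_f' Ge·A`);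
* `TxxR_eq / TxbR_eq / TbxR_eq / TbbR_eq` — the four middle-Gram blocks are `TgenR gN gN vN Nm` at glued indices
  (`m₀ = B + Nm`);
* `HxxR_eq / HxbR_eq / HbxR_eq / HbbR_eq` — the four Hankel blocks are `TgenR AN GAN 1 (4D) + TgenR AN AN ceN (4D)`.

Finite-sum bookkeeping only; standard axioms; no RH claim.
-/

set_option autoImplicit false
-- `Summit.RiemannHypothesis.RiemannHypothesis.…` is the layout-mandated namespace (summit = problem name).
set_option linter.dupNamespace false

open Finset

noncomputable section

namespace Summit.RiemannHypothesis.RiemannHypothesis.Theorems.WeilFormatC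

namespace CinfGlueE

variable {r D : ℕ}

open CinfGlue (uf flat flat_of_lt sum_flatten)

/-! ## The glued tables -/

section Tables

variable (B : ℕ) (Kb : ℕ → ℕ → ℝ) (Fc : Fin r → ℕ → ℝ) (sq : ℝ) (Xr : Fin r → ℕ → ℝ)
  (se : Finset ℕ) (coef : Fin r → ℕ → ℝ)
  (Prow Pimg : ℕ → Fin 4 × Fin D → ℝ) (Rtab : Fin r → Fin 4 × Fin D → ℝ)
  (Ge : Fin 4 × Fin D → Fin 4 × Fin D → ℝ) (ce : Fin 4 × Fin D → ℝ) (wmid : ℕ → ℝ)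
  (Λ1 : Fin r → Fin B → ℝ) (Λ2 : Fin r → Fin r → ℝ)

/-- Glued resolved middle columns: row `p < B` = x-row `p`, row `B + j` = β-row `j`; column `t ↔ m = B + t`. -/
def gN (p t : ℕ) : ℝ :=
  if hp : p < B then CinfStageE.gxR B Kb Fc sq Λ1 ⟨p, hp⟩ (B + t)
  else if hq : p - B < r then CinfStageE.gbR B Kb Fc sq Xr Λ2 ⟨p - B, hq⟩ (B + t) else 0

/-- Middle weights on the column index: `1 / wmid (B + t)`. -/
def vN (t : ℕ) : ℝ := 1 / wmid (B + t)

/-- Glued, flattened family matrix: row `p` (x then β), column `f < 4D`. -/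
def AN (p f : ℕ) : ℝ :=
  flat D (fun y ↦ if hp : p < B then CinfStageE.AxR B Prow Rtab Λ1 ⟨p, hp⟩ y
    else if hq : p - B < r then CinfStageE.AbR B se coef Fc sq Prow Pimg Rtab Λ2 ⟨p - B, hq⟩ y else 0) f

/-- Flattened Hankel midpoints. -/
def GeN (f f' : ℕ) : ℝ := flat D (fun y ↦ flat D (fun y' ↦ Ge y y') f') f

/-- Flattened Hankel Gershgorin weights. -/
def ceN (f : ℕ) : ℝ := flat D ce f

/-- `Σ_{f'<4D} GeN f f' · AN p f'` (the `Hmid·A` table, rows `p`, columns `f`). -/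
def GAN (p f : ℕ) : ℝ := ∑ f' ∈ range (4 * D), GeN (D := D) Ge f f' * AN B Fc sq se coef Prow Pimg Rtab Λ1 Λ2 p f'

/-! ## Middle-Gram blocks -/

variable {B} {m₀ Nm : ℕ}

/-- (helper) `gN_x`. -/
private theorem gN_x (i : Fin B) (t : ℕ) :
    gN B Kb Fc sq Xr Λ1 Λ2 i t = CinfStageE.gxR B Kb Fc sq Λ1 i (B + t) := by
  simp only [gN, dif_pos i.isLt, Fin.eta]

/-- (helper) `gN_b`. -/
private theorem gN_b (j : Fin r) (t : ℕ) :
    gN B Kb Fc sq Xr Λ1 Λ2 (B + j) t = CinfStageE.gbR B Kb Fc sq Xr Λ2 j (B + t) := by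
  have h1 : ¬ (B + (j : ℕ) < B) := by omega
  simp only [gN, dif_neg h1, Nat.add_sub_cancel_left, dif_pos j.isLt, Fin.eta]

/-- (helper) `sum_Ico_mid`. -/
private theorem sum_Ico_mid (hm : m₀ = B + Nm) (F : ℕ → ℝ) :
    ∑ m ∈ Finset.Ico B m₀, F m = ∑ t ∈ range Nm, F (B + t) := by
  rw [hm, Finset.sum_Ico_eq_sum_range, Nat.add_sub_cancel_left]

/-- **(x,x) middle Gram** as the generic stage table. -/
theorem TxxR_eq (hm : m₀ = B + Nm) (i i' : Fin B) :
    CinfStageE.TxxR B Kb Fc sq wmid Λ1 m₀ i i'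
      = CinfStageT.TgenR (gN B Kb Fc sq Xr Λ1 Λ2) (gN B Kb Fc sq Xr Λ1 Λ2) (vN B wmid) Nm i i' := by
  rw [CinfStageE.TxxR, sum_Ico_mid hm, CinfStageT.TgenR]
  refine Finset.sum_congr rfl fun t _ ↦ ?_
  rw [gN_x, gN_x, vN]; ring

/-- **(x,β) middle Gram** as the generic stage table. -/
theorem TxbR_eq (hm : m₀ = B + Nm) (i : Fin B) (j₁ : Fin r) :
    CinfStageE.TxbR B Kb Fc sq Xr wmid Λ1 Λ2 m₀ i j₁
      = CinfStageT.TgenR (gN B Kb Fc sq Xr Λ1 Λ2) (gN B Kb Fc sq Xr Λ1 Λ2) (vN B wmid) Nm i (B + j₁) := by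
  rw [CinfStageE.TxbR, sum_Ico_mid hm, CinfStageT.TgenR]
  refine Finset.sum_congr rfl fun t _ ↦ ?_
  rw [gN_x, gN_b, vN]; ring

/-- **(β,x) middle Gram** as the generic stage table. -/
theorem TbxR_eq (hm : m₀ = B + Nm) (j₁ : Fin r) (i : Fin B) :
    CinfStageE.TbxR B Kb Fc sq Xr wmid Λ1 Λ2 m₀ j₁ i
      = CinfStageT.TgenR (gN B Kb Fc sq Xr Λ1 Λ2) (gN B Kb Fc sq Xr Λ1 Λ2) (vN B wmid) Nm (B + j₁) i := by
  rw [CinfStageE.TbxR, sum_Ico_mid hm, CinfStageT.TgenR]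
  refine Finset.sum_congr rfl fun t _ ↦ ?_
  rw [gN_x, gN_b, vN]; ring

/-- **(β,β) middle Gram** as the generic stage table. -/
theorem TbbR_eq (hm : m₀ = B + Nm) (j₁ j₂ : Fin r) :
    CinfStageE.TbbR B Kb Fc sq Xr wmid Λ2 m₀ j₁ j₂
      = CinfStageT.TgenR (gN B Kb Fc sq Xr Λ1 Λ2) (gN B Kb Fc sq Xr Λ1 Λ2) (vN B wmid) Nm (B + j₁) (B + j₂) := by
  rw [CinfStageE.TbbR, sum_Ico_mid hm, CinfStageT.TgenR]
  refine Finset.sum_congr rfl fun t _ ↦ ?_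
  rw [gN_b, gN_b, vN]; ring

/-! ## Hankel blocks -/

/-- (helper) `AN_x`. -/
private theorem AN_x (i : Fin B) {f : ℕ} (hf : f < 4 * D) :
    AN B Fc sq se coef Prow Pimg Rtab Λ1 Λ2 i f = CinfStageE.AxR B Prow Rtab Λ1 i (uf D f hf) := by
  simp only [AN, flat, dif_pos hf, dif_pos i.isLt, Fin.eta]

/-- (helper) `AN_b`. -/
private theorem AN_b (j : Fin r) {f : ℕ} (hf : f < 4 * D) :
    AN B Fc sq se coef Prow Pimg Rtab Λ1 Λ2 (B + j) f
      = CinfStageE.AbR B se coef Fc sq Prow Pimg Rtab Λ2 j (uf D f hf) := by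
  have h1 : ¬ (B + (j : ℕ) < B) := by omega
  simp only [AN, flat, dif_pos hf, dif_neg h1, Nat.add_sub_cancel_left, dif_pos j.isLt, Fin.eta]

/-- (helper) `GeN_of`. -/
private theorem GeN_of {f f' : ℕ} (hf : f < 4 * D) (hf' : f' < 4 * D) :
    GeN (D := D) Ge f f' = Ge (uf D f hf) (uf D f' hf') := by
  simp only [GeN, flat, dif_pos hf, dif_pos hf']

/-- (helper) `ceN_of`. -/
private theorem ceN_of {f : ℕ} (hf : f < 4 * D) : ceN (D := D) ce f = ce (uf D f hf) := by
  simp only [ceN, flat, dif_pos hf]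

/-- The generic form of a Hankel block for two family rows `a`, `b` read through `AN` at glued rows `p`, `p'`. -/
private theorem hankel_generic (p p' : ℕ) (a b : Fin 4 × Fin D → ℝ)
    (ha : ∀ {f : ℕ} (hf : f < 4 * D), AN B Fc sq se coef Prow Pimg Rtab Λ1 Λ2 p f = a (uf D f hf))
    (hb : ∀ {f : ℕ} (hf : f < 4 * D), AN B Fc sq se coef Prow Pimg Rtab Λ1 Λ2 p' f = b (uf D f hf)) :
    ((∑ y, ∑ y', a y * b y' * Ge y y') + ∑ y, ce y * a y * b y)
      = CinfStageT.TgenR (AN B Fc sq se coef Prow Pimg Rtab Λ1 Λ2) (GAN B Fc sq se coef Prow Pimg Rtab Ge Λ1 Λ2)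
          (fun _ ↦ 1) (4 * D) p p'
        + CinfStageT.TgenR (AN B Fc sq se coef Prow Pimg Rtab Λ1 Λ2) (AN B Fc sq se coef Prow Pimg Rtab Λ1 Λ2)
          (ceN (D := D) ce) (4 * D) p p' := by
  congr 1
  · -- double sum
    rw [CinfStageT.TgenR, sum_flatten]
    refine Finset.sum_congr rfl fun f hf ↦ ?_
    have hf' := Finset.mem_range.1 hf
    rw [flat, dif_pos hf', sum_flatten, GAN, mul_one, Finset.mul_sum]
    refine Finset.sum_congr rfl fun g hg ↦ ?_
    have hg' := Finset.mem_range.1 hg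
    rw [flat, dif_pos hg', ha hf', hb hg', GeN_of Ge hf' hg']
    ring
  · rw [CinfStageT.TgenR, sum_flatten]
    refine Finset.sum_congr rfl fun f hf ↦ ?_
    have hf' := Finset.mem_range.1 hf
    rw [flat, dif_pos hf', ha hf', hb hf', ceN_of ce hf']
    ring

/-- **(x,x) Hankel block** as the sum of the two generic stage tables. -/
theorem HxxR_eq (i i' : Fin B) :
    CinfStageE.HxxR B Prow Rtab Ge ce Λ1 i i'
      = CinfStageT.TgenR (AN B Fc sq se coef Prow Pimg Rtab Λ1 Λ2) (GAN B Fc sq se coef Prow Pimg Rtab Ge Λ1 Λ2)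
          (fun _ ↦ 1) (4 * D) i i'
        + CinfStageT.TgenR (AN B Fc sq se coef Prow Pimg Rtab Λ1 Λ2) (AN B Fc sq se coef Prow Pimg Rtab Λ1 Λ2)
          (ceN (D := D) ce) (4 * D) i i' := by
  rw [CinfStageE.HxxR]
  exact hankel_generic Fc sq se coef Prow Pimg Rtab Ge ce Λ1 Λ2 i i' _ _
    (fun hf ↦ AN_x Fc sq se coef Prow Pimg Rtab Λ1 Λ2 i hf) (fun hf ↦ AN_x Fc sq se coef Prow Pimg Rtab Λ1 Λ2 i' hf)

/-- **(x,β) Hankel block.** -/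
theorem HxbR_eq (i : Fin B) (j₁ : Fin r) :
    CinfStageE.HxbR B Fc sq se coef Prow Pimg Rtab Ge ce Λ1 Λ2 i j₁
      = CinfStageT.TgenR (AN B Fc sq se coef Prow Pimg Rtab Λ1 Λ2) (GAN B Fc sq se coef Prow Pimg Rtab Ge Λ1 Λ2)
          (fun _ ↦ 1) (4 * D) i (B + j₁)
        + CinfStageT.TgenR (AN B Fc sq se coef Prow Pimg Rtab Λ1 Λ2) (AN B Fc sq se coef Prow Pimg Rtab Λ1 Λ2)
          (ceN (D := D) ce) (4 * D) i (B + j₁) := by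
  rw [CinfStageE.HxbR]
  exact hankel_generic Fc sq se coef Prow Pimg Rtab Ge ce Λ1 Λ2 i (B + j₁) _ _
    (fun hf ↦ AN_x Fc sq se coef Prow Pimg Rtab Λ1 Λ2 i hf) (fun hf ↦ AN_b Fc sq se coef Prow Pimg Rtab Λ1 Λ2 j₁ hf)

/-- **(β,x) Hankel block.** -/
theorem HbxR_eq (j₁ : Fin r) (i : Fin B) :
    CinfStageE.HbxR B Fc sq se coef Prow Pimg Rtab Ge ce Λ1 Λ2 j₁ i
      = CinfStageT.TgenR (AN B Fc sq se coef Prow Pimg Rtab Λ1 Λ2) (GAN B Fc sq se coef Prow Pimg Rtab Ge Λ1 Λ2)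
          (fun _ ↦ 1) (4 * D) (B + j₁) i
        + CinfStageT.TgenR (AN B Fc sq se coef Prow Pimg Rtab Λ1 Λ2) (AN B Fc sq se coef Prow Pimg Rtab Λ1 Λ2)
          (ceN (D := D) ce) (4 * D) (B + j₁) i := by
  rw [CinfStageE.HbxR]
  exact hankel_generic Fc sq se coef Prow Pimg Rtab Ge ce Λ1 Λ2 (B + j₁) i _ _
    (fun hf ↦ AN_b Fc sq se coef Prow Pimg Rtab Λ1 Λ2 j₁ hf) (fun hf ↦ AN_x Fc sq se coef Prow Pimg Rtab Λ1 Λ2 i hf)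

/-- **(β,β) Hankel block.** -/
theorem HbbR_eq (j₁ j₂ : Fin r) :
    CinfStageE.HbbR B Fc sq se coef Prow Pimg Rtab Ge ce Λ2 j₁ j₂
      = CinfStageT.TgenR (AN B Fc sq se coef Prow Pimg Rtab Λ1 Λ2) (GAN B Fc sq se coef Prow Pimg Rtab Ge Λ1 Λ2)
          (fun _ ↦ 1) (4 * D) (B + j₁) (B + j₂)
        + CinfStageT.TgenR (AN B Fc sq se coef Prow Pimg Rtab Λ1 Λ2) (AN B Fc sq se coef Prow Pimg Rtab Λ1 Λ2)
          (ceN (D := D) ce) (4 * D) (B + j₁) (B + j₂) := by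
  rw [CinfStageE.HbbR]
  exact hankel_generic Fc sq se coef Prow Pimg Rtab Ge ce Λ1 Λ2 (B + j₁) (B + j₂) _ _
    (fun hf ↦ AN_b Fc sq se coef Prow Pimg Rtab Λ1 Λ2 j₁ hf) (fun hf ↦ AN_b Fc sq se coef Prow Pimg Rtab Λ1 Λ2 j₂ hf)

end Tables

end CinfGlueE

end Summit.RiemannHypothesis.RiemannHypothesis.Theorems.WeilFormatC

end
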